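import Literature.RingTheory.Etale.IndEtaleFactorization
import Mathlib.RingTheory.Etale.Weakly
import Mathlib.RingTheory.Unramified.Finite
import Mathlib.RingTheory.Localization.BaseChange
import Mathlib.RingTheory.IntegralClosure.IsIntegralClosure.Basic
import HarnessLib

/-!
# Ind-étale algebras over a field; localizations are weakly étale

Two small inputs of the proof of Bhatt–Scholze's Theorem 2.3.4 (Stacks Project, Tag 097Z):

* `FactorsEtale.isIntegral_of_field`, `FactorsEtale.isMaximal_of_isPrime` — over a field `K`, an
  algebra satisfying the ind-étale factorization criterion is integral over `K`, hence **every
  prime ideal is maximal** (an étale `K`-algebra is finite, Mathlib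
  `Algebra.FormallyUnramified.finite_of_free`; Stacks Project, Tag 092Q/092R: weakly étale, in
  particular ind-étale, algebras over fields are integral with separable algebraic residue
  fields). This is what makes the fibres of an ind-étale cover zero-dimensional.
* `weaklyEtale_of_isLocalization` — **a localization is weakly étale** (Stacks Project,
  Tag 092N (1)): `R → S⁻¹R` is flat and `S⁻¹R ⊗_R S⁻¹R → S⁻¹R` is an isomorphism (Mathlib
  `IsLocalization.bijective_linearMap_mul'`).

## References

* The Stacks Project, Tags 092N, 092Q, 092R, 097I. [StacksProject]

## Design notes

Mathlib searched: `Algebra.WeaklyEtale` (étale ⇒ weakly étale, base change, composition — no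
localization instance), `IsLocalization.bijective_linearMap_mul'`, `IsLocalization.flat`,
`isField_of_isIntegral_of_isField'`. Nothing restated.
-/

universe u v

namespace Literature.RingTheory.Etale

open TensorProduct

/-! ### Ind-étale algebras over a field are integral -/

/-- **An algebra over a field satisfying the ind-étale factorization criterion is integral**:
every element lies in the image of an étale, hence finite, `K`-algebra.
[cite: StacksProject, Tag 092Q] -/
theorem FactorsEtale.isIntegral_of_field {K D : Type u} [Field K] [CommRing D] [Algebra K D]
    (h : FactorsEtale K D) : Algebra.IsIntegral K D := by
  refine ⟨fun d => ?_⟩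
  obtain ⟨B, _, _, _, α, β, hαβ⟩ := h (Polynomial K) (Polynomial.aeval d)
  haveI : Module.Finite K B := Algebra.FormallyUnramified.finite_of_free K B
  have hd : β (α Polynomial.X) = d := by
    rw [← AlgHom.comp_apply, hαβ, Polynomial.aeval_X]
  rw [← hd]
  exact (Algebra.IsIntegral.isIntegral (R := K) (α Polynomial.X)).map β

/-- **Every prime ideal of an ind-étale algebra over a field is maximal** (the quotient is a
domain integral over a field, hence a field). [cite: StacksProject, Tag 092R] -/
theorem FactorsEtale.isMaximal_of_isPrime {K D : Type u} [Field K] [CommRing D] [Algebra K D]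
    (h : FactorsEtale K D) (P : Ideal D) [P.IsPrime] : P.IsMaximal := by
  haveI := h.isIntegral_of_field
  exact Ideal.Quotient.maximal_of_isField P
    (isField_of_isIntegral_of_isField' (R := K) (S := D ⧸ P) (Field.toIsField K))

/-! ### Localizations are weakly étale -/

/-- **A localization is weakly étale**: `R → S⁻¹R` is flat and the multiplication map
`S⁻¹R ⊗_R S⁻¹R → S⁻¹R` is bijective, in particular flat. [cite: StacksProject, Tag 092N] -/
theorem weaklyEtale_of_isLocalization {R : Type u} [CommRing R] (S : Submonoid R) (Rₛ : Type v)
    [CommRing Rₛ] [Algebra R Rₛ] [IsLocalization S Rₛ] : Algebra.WeaklyEtale R Rₛ where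
  flat := IsLocalization.flat Rₛ S
  flat_lmul' := by
    refine RingHom.Flat.of_bijective ?_
    have hb := IsLocalization.bijective_linearMap_mul' (R := R) (A := Rₛ) S
    have heq : ⇑(Algebra.TensorProduct.lmul' (S := Rₛ) R) = ⇑(LinearMap.mul' R Rₛ) := by
      ext x
      rfl
    change Function.Bijective ⇑(Algebra.TensorProduct.lmul' (S := Rₛ) R)
    rw [heq]
    exact hb

/-- A localization of `R` is weakly étale over `R` (instance for `Localization S`).
[cite: StacksProject, Tag 092N] -/
instance weaklyEtale_localization {R : Type u} [CommRing R] (S : Submonoid R) :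
    Algebra.WeaklyEtale R (Localization S) :=
  weaklyEtale_of_isLocalization S (Localization S)

end Literature.RingTheory.Etale
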